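import Summits.ResolutionOfSingularities.ResolutionOfSingularities.Theorems.FrobeniusLadderFInjectiveMacaulayficationNonFullLocusClosed
import Summits.ResolutionOfSingularities.ResolutionOfSingularities.Theorems.FrobeniusLadderFInjectiveMacaulayficationFCForallExists
import Summits.ResolutionOfSingularities.ResolutionOfSingularities.Theorems.FrobeniusLadderFInjectiveMacaulayficationRegularPointClause
import Summits.ResolutionOfSingularities.ResolutionOfSingularities.Theorems.FrobeniusLadderFInjectiveMacaulayficationIsBlowupStalkTransfer
import Summits.ResolutionOfSingularities.ResolutionOfSingularities.Theorems.FrobeniusLadderFInjectiveMacaulayficationIsBlowupStalkOffSupport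
import Summits.ResolutionOfSingularities.ResolutionOfSingularities.Theorems.FrobeniusLadderFInjectiveMacaulayficationCentreSpread
import Summits.ResolutionOfSingularities.ResolutionOfSingularities.Theorems.FrobeniusLadderFInjectiveMacaulayficationDegreeZeroDescentLocal
import Literature.AlgebraicGeometry.Resolution.BlowupAlgebraPrimesPoints
import Literature.AlgebraicGeometry.Resolution.KollarBlowupSequenceFunctors
import Literature.AlgebraicGeometry.Resolution.NearPointsSigmaLocal
import Literature.AlgebraicGeometry.Resolution.MarkedIdeals
import Literature.AlgebraicGeometry.Resolution.QuasiExcellentSchemes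
import Literature.AlgebraicGeometry.Resolution.BlowupsExistence
import Literature.AlgebraicGeometry.Resolution.BlowupsIntegral
import Literature.AlgebraicGeometry.Resolution.BlowupsProperProofs
import Literature.AlgebraicGeometry.Resolution.BlowupDimension
import Literature.AlgebraicGeometry.Resolution.BlowupStalkBlowupAlgebra
import Literature.AlgebraicGeometry.Dimension.FibreLocalRingDimension
import Mathlib.AlgebraicGeometry.Morphisms.Finite
import Mathlib.Algebra.CharP.Algebra
import HarnessLib

/-!
# FC′ IN DIMENSION ≤ 2 WITHOUT RESOLUTION OF SURFACES — the r2 rung modulo the S₂-modification and the finite-modification-of-a-blow-up lemma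
# (crux `FInjectiveMacaulayfication` stmt-ResolutionOfSingularities-15315, chain w45a, hole #3γ; res-L1-w45a-plan-1 R13.12 (5) / R13.25 (2);
# text res-L1-w45a-strat-1 `FCRungsSig.lean` v2.4 §B, filer res-L1-w45a-stub-2)

[OURS · L1 W4.5a] Support file (`--supports stmt-ResolutionOfSingularities-15315 --as helper`); NOT a statement of any manuscript; no named
fact introduced (Datta–Murayama Thm. B is used BY NAME through `…NonFullLocusClosed`); AI-written (AI review is weaker than expert review).

`FCForallExistsDimLe2` is `GenericFibreReduction.FCForallExists` (the v29 door stub `stub_fcForallExists`, currency (A′)) VERBATIM with the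
single extra hypothesis `topologicalKrullDim X₁ ≤ 2`. It is PROVED here (`fcForallExistsDimLe2_of_named`) modulo: Datta–Murayama Thm. B
(tree named fact, BY NAME), `NonFullLocusClosed.CMLocusOpen` (EGA IV_2 6.11.2), and two folklore inputs declared as `@[conjecture] def`s —
S-S2 `S2Modification` (the S₂-modification of an integral surface along a closed set off which it is Cohen–Macaulay) and S-V
`FiniteModificationOfBlowupIsBlowup` (a finite modification of a blowing up, stalk-iso off the centre, is one blowing up with the same support;
reduced to two affine-local statements in `…FiniteModificationOfBlowup`). NO resolution of surfaces is used.

CONSTRUCTION. Given the point-fix datum `c` at `η`: (i) spread `(c)` to `J₀ ≠ 0` with `J₀,η = (c)` (`CentreSpread`); (ii) `π : X₂ = Bl_{J₀} X₁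
→ X₁`; (iii) `X₂` is FULL over `η` (its stalks over `η` are the charts of `Bl_(c) Spec 𝒪_η`, FULL by hypothesis) and FULL off `π⁻¹ supp J₀`
(`X₁` is Cohen–Macaulay with F-injective generizations there); (iv) `F := π⁻¹(supp J₀) ∩ nonFULL(X₂)` is closed (`NonFullLocusClosed`) and
misses the fibre over `η`; (v) the S₂-modification `g : X₃ → X₂` along `F` (`S2Modification`: finite, stalk-iso off `F`, stalks over `F`
Cohen–Macaulay and integrally closed in dimension ≤ 1, hence regular there by S-N1); (vi) `X₃ → X₁` is a blowing up along some `J` with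
`supp J = supp J₀` (`FiniteModificationOfBlowupIsBlowup`), `J_η = J₀,η·(unit)`-wise the LocFix datum is RE-CHOSEN as generators of `J_η`
(currency (A′)); (vii) every blowing up along `J` has the stalks of `X₃` (`IsBlowup.unique`): (nc) at non-closed points (local dimension ≤ 1
over `F`: regular; off `F`: stalks of `X₂`, FULL) and (cl) everywhere over `supp J`. In dimension ≤ 2 the witness exists at EVERY point
carrying a point-fix datum (the hypothesis `hη` of FC′ is not used).

[folklore assembly; cite: DattaMurayama2024, Thm. B; EGAIV2, 5.10.16–17 and 6.11.2; EGAII, 8.1; StacksProject, Tags 080A, 080B, 0804, 0805]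
-/

-- single-problem summit: the doubled namespace component is forced
set_option linter.dupNamespace false

noncomputable section

open AlgebraicGeometry CategoryTheory Literature.AlgebraicGeometry.Resolution TopologicalSpace IsLocalRing
open Scheme.IdealSheafData

namespace Summit.ResolutionOfSingularities.ResolutionOfSingularities.Theorems.FInjectiveMacaulayfication.FCForallExistsDimLe2

open Summit.ResolutionOfSingularities.ResolutionOfSingularities.Theorems.FInjectiveMacaulayfication
open Summit.ResolutionOfSingularities.ResolutionOfSingularities.Theorems.FInjectiveMacaulayfication.GenericFibreReduction
open Summit.ResolutionOfSingularities.ResolutionOfSingularities.Theorems.FInjectiveMacaulayfication.NonFullLocusClosed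

/-- [OURS · candidate statement, PROVED below modulo the inputs] **FC′ restricted to surfaces (and curves)** — `GenericFibreReduction.FCForallExists` VERBATIM with the single
extra hypothesis `topologicalKrullDim X₁ ≤ 2` inserted after `IsIntegral X₁`. [candidate statement, OURS] -/
@[conjecture] def FCForallExistsDimLe2 : Prop :=
  ∀ (p : ℕ), p.Prime → ∀ (k : Type) [Field k] [CharP k p]
    (X₁ : Scheme.{0}) (f₁ : X₁ ⟶ Spec (.of k)),
      IsSeparated f₁ → LocallyOfFiniteType f₁ → QuasiCompact f₁ → IsIntegral X₁ → topologicalKrullDim X₁ ≤ 2 →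
      (∀ x : X₁, (∀ d : ℕ, ringKrullDim (X₁.presheaf.stalk x) = d → ∀ s : Fin d → X₁.presheaf.stalk x,
        (Ideal.span (Set.range s)).radical.IsMaximal → RingTheory.Sequence.IsWeaklyRegular (X₁.presheaf.stalk x) (List.ofFn s))) →
      ∀ η : X₁, (¬ IsClosed ({η} : Set X₁) ∧ ¬ (∀ d : ℕ, ringKrullDim (X₁.presheaf.stalk η) = d → ∀ s : Fin d → X₁.presheaf.stalk η,
          (Ideal.span (Set.range s)).radical.IsMaximal → ∀ t : X₁.presheaf.stalk η, (∃ e : ℕ, t ^ p ^ e ∈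
            Ideal.span ((fun z : X₁.presheaf.stalk η => z ^ p ^ e) '' (Ideal.span (Set.range s) : Set (X₁.presheaf.stalk η)))) →
              t ∈ Ideal.span (Set.range s)) ∧
        ∀ y : X₁, y ⤳ η → y ≠ η → (∀ d : ℕ, ringKrullDim (X₁.presheaf.stalk y) = d → ∀ s : Fin d → X₁.presheaf.stalk y,
          (Ideal.span (Set.range s)).radical.IsMaximal → ∀ t : X₁.presheaf.stalk y, (∃ e : ℕ, t ^ p ^ e ∈
            Ideal.span ((fun z : X₁.presheaf.stalk y => z ^ p ^ e) '' (Ideal.span (Set.range s) : Set (X₁.presheaf.stalk y)))) →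
              t ∈ Ideal.span (Set.range s))) →
      ∀ (n : ℕ) (c : Fin n → X₁.presheaf.stalk η), Ideal.span (Set.range c) ≠ ⊥ →
        (Ideal.span (Set.range c)).radical = maximalIdeal (X₁.presheaf.stalk η) →
        (∀ (j : Fin n) (𝔔 : PrimeSpectrum (blowupAlgebra (Ideal.span (Set.range c)) (c j))),
          𝔔.asIdeal.comap (algebraMap (X₁.presheaf.stalk η) (blowupAlgebra (Ideal.span (Set.range c)) (c j))) =
            maximalIdeal (X₁.presheaf.stalk η) →
          IsDomain (Localization.AtPrime 𝔔.asIdeal) ∧ ∀ d : ℕ, ringKrullDim (Localization.AtPrime 𝔔.asIdeal) = d →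
            ∀ s : Fin d → Localization.AtPrime 𝔔.asIdeal, (Ideal.span (Set.range s)).radical.IsMaximal →
              RingTheory.Sequence.IsWeaklyRegular (Localization.AtPrime 𝔔.asIdeal) (List.ofFn s) ∧
              ∀ y : Localization.AtPrime 𝔔.asIdeal, (∃ e : ℕ, y ^ p ^ e ∈ Ideal.span ((fun z : Localization.AtPrime 𝔔.asIdeal => z ^ p ^ e) ''
                (Ideal.span (Set.range s) : Set (Localization.AtPrime 𝔔.asIdeal)))) → y ∈ Ideal.span (Set.range s)) →
      ∃ (J : X₁.IdealSheafData) (n' : ℕ) (c' : Fin n' → X₁.presheaf.stalk η), J ≠ ⊥ ∧ η ∈ (J.support : Set X₁) ∧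
      -- the RE-CHOSEN LocFix datum c' at η (currency (A′)): nonzero, inside 𝔪_η, charts FULL over 𝔪_η
      Ideal.span (Set.range c') ≠ ⊥ ∧ Ideal.span (Set.range c') ≤ maximalIdeal (X₁.presheaf.stalk η) ∧
        (∀ (j : Fin n') (𝔔 : PrimeSpectrum (blowupAlgebra (Ideal.span (Set.range c')) (c' j))),
          𝔔.asIdeal.comap (algebraMap (X₁.presheaf.stalk η) (blowupAlgebra (Ideal.span (Set.range c')) (c' j))) =
            maximalIdeal (X₁.presheaf.stalk η) →
          IsDomain (Localization.AtPrime 𝔔.asIdeal) ∧ ∀ d : ℕ, ringKrullDim (Localization.AtPrime 𝔔.asIdeal) = d →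
            ∀ s : Fin d → Localization.AtPrime 𝔔.asIdeal, (Ideal.span (Set.range s)).radical.IsMaximal →
              RingTheory.Sequence.IsWeaklyRegular (Localization.AtPrime 𝔔.asIdeal) (List.ofFn s) ∧
              ∀ y : Localization.AtPrime 𝔔.asIdeal, (∃ e : ℕ, y ^ p ^ e ∈ Ideal.span ((fun z : Localization.AtPrime 𝔔.asIdeal => z ^ p ^ e) ''
                (Ideal.span (Set.range s) : Set (Localization.AtPrime 𝔔.asIdeal)))) → y ∈ Ideal.span (Set.range s)) ∧
      stalkIdeal J η = Ideal.span (Set.range c') ∧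
      (∀ (X₂ : Scheme.{0}) (π : X₂ ⟶ X₁), IsBlowup π J →
        (∀ x : X₂, π.base x ∈ (J.support : Set X₁) → π.base x ≠ η → ¬ IsClosed ({x} : Set X₂) →
          IsDomain (X₂.presheaf.stalk x) ∧ ∀ d : ℕ, ringKrullDim (X₂.presheaf.stalk x) = d → ∀ s : Fin d → X₂.presheaf.stalk x,
            (Ideal.span (Set.range s)).radical.IsMaximal → RingTheory.Sequence.IsWeaklyRegular (X₂.presheaf.stalk x) (List.ofFn s) ∧
            ∀ t : X₂.presheaf.stalk x, (∃ e : ℕ, t ^ p ^ e ∈ Ideal.span ((fun z : X₂.presheaf.stalk x => z ^ p ^ e) ''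
              (Ideal.span (Set.range s) : Set (X₂.presheaf.stalk x)))) → t ∈ Ideal.span (Set.range s)) ∧
        (∀ x : X₂, π.base x ∈ (J.support : Set X₁) → IsClosed ({x} : Set X₂) →
          ∀ d : ℕ, ringKrullDim (X₂.presheaf.stalk x) = d → ∀ s : Fin d → X₂.presheaf.stalk x,
            (Ideal.span (Set.range s)).radical.IsMaximal → RingTheory.Sequence.IsWeaklyRegular (X₂.presheaf.stalk x) (List.ofFn s)))

/-- §B0 sanity: the dim ≤ 2 rung is a weakening of FC′. -/
theorem fcForallExistsDimLe2_of_fc (h : FCForallExists) : FCForallExistsDimLe2 := by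
  intro p hp k _ _ X₁ f₁ hsep hft hqc hint _hdim
  exact h p hp k X₁ f₁ hsep hft hqc hint

/-! ## The two folklore inputs, typed -/

/-- INPUT S-S2 [candidate statement, OURS] **the S₂-modification along a closed set.** For `X₂` integral of finite type over
a field with `dim X₂ ≤ 2` and a closed `F ⊆ X₂` off which `X₂` is Cohen–Macaulay, there is a finite surjective `g : X₃ → X₂` from
an integral Noetherian `X₃` that is an isomorphism on stalks off `F` and whose stalks over `F` are Cohen–Macaulay and, when of
dimension ≤ 1, integrally closed. CONSTRUCTION (folklore): `X₃ := Spec_{X₂} 𝒜`, `𝒜 ⊆ ν_*𝒪_{X₂^ν}` the sections of the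
(finite) normalisation that are sections of `𝒪_{X₂}` off `F`; over a point of `F` of local dimension 2 the stalk `A` equals
`⋂_{ht 𝔭 = 1} A_𝔭` (a rational function in that intersection lies in the normalisation and is regular at the codimension-1
generizations off `F`; its poles on the S₂ open `X₂ ∖ F` are divisorial and finitely many, so it is a section of `𝒜` near the
point), i.e. `A` is S₂ = Cohen–Macaulay; over the generic point of a curve inside `F` the stalk is a localisation of the
normalisation, a DVR. Why it might fail: a typing slip only (e.g. without «Cohen–Macaulay off `F`» or without `dim ≤ 2` the
conclusion «Cohen–Macaulay over `F`» is false/too strong). [folklore; cf. EGA IV_2 5.10.16–17, 7.8.3] -/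
@[conjecture] def S2Modification : Prop :=
  ∀ (k : Type) [Field k] (X₂ : Scheme.{0}) (f₂ : X₂ ⟶ Spec (.of k)),
    LocallyOfFiniteType f₂ → QuasiCompact f₂ → IsIntegral X₂ → topologicalKrullDim X₂ ≤ 2 →
    ∀ F : Set X₂, IsClosed F → (∀ y : X₂, y ∉ F → CMClause (X₂.presheaf.stalk y)) →
    ∃ (X₃ : Scheme.{0}) (g : X₃ ⟶ X₂), IsIntegral X₃ ∧ IsNoetherian X₃ ∧ IsFinite g ∧ Function.Surjective g.base ∧
      (∀ x₃ : X₃, g.base x₃ ∉ F → IsIso (g.stalkMap x₃)) ∧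
      (∀ x₃ : X₃, g.base x₃ ∈ F →
        CMClause (X₃.presheaf.stalk x₃) ∧ (ringKrullDim (X₃.presheaf.stalk x₃) ≤ 1 → IsIntegrallyClosed (X₃.presheaf.stalk x₃)))

/-- INPUT S-V [folklore; the Veronese blow-up lemma, finite form] **a finite modification of a blowing up which is a
stalk isomorphism off the centre's support is again ONE blowing up of the base, along an ideal sheaf with the same support.**
PROOF SKETCH: `f := g ≫ π` is proper; `𝓘 := J₀·𝒪_{X₃}` is invertible and `f`-ample (pull-back of `𝒪_π(1)` along the finite `g`,
Stacks 0892); `S := ⊕ₙ f_*𝓘ⁿ ⊆ K[T]` is a finitely generated graded `𝒪_{X₁}`-algebra (EGA III 2.3.2) with `X₃ ≅ Proj S` over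
`X₁` (EGA II 4.6.3 + properness); some Veronese subalgebra `S^{(N)}` is generated in degree 1 (EGA II 2.1.6 (v) / Stacks 0EGH)
and for `N ≫ 0` its degree-1 part `J := f_*𝓘ᴺ` lies in `𝒪_{X₁}` (`f_*𝒪_{X₃}/𝒪_{X₁}` is coherent and supported in `supp J₀`,
so `J₀ᴹ·f_*𝒪_{X₃} ⊆ 𝒪_{X₁}`, and `⊕_{n ≥ n₀} f_*𝓘ⁿ` is finite over `⊕ J₀ⁿ`), whence `S^{(N)} = ⊕ₙ Jⁿ` inside `K[T]` and
`X₃ ≅ Proj S ≅ Proj S^{(N)} = Bl_J X₁` over `X₁`; `supp J = supp J₀` since `J = 𝒪` where `f` is an isomorphism and `J ⊆ 𝔪_y`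
over `supp J₀` (the fibres are non-empty). Liu 2002 Thm. 8.1.24 = Hartshorne II.7.17 is the quasi-projective case WITHOUT support
control (tree: `Liu2002Thm8124Projective`, projective case); no quasi-projectivity of `X₁` is needed here because `𝓘` is already
`f`-ample. Why it might fail: a typing slip only (e.g. dropping «stalk isomorphism off `supp J₀`» breaks `supp J = supp J₀`).
[cite: EGAII, 4.6.3, 3.1.8 and 2.1.6; EGAIII1, 2.3.2; Liu2002, Lemma 8.1.23 and Thm. 8.1.24] -/
@[conjecture] def FiniteModificationOfBlowupIsBlowup : Prop :=
  ∀ (X₁ X₂ X₃ : Scheme.{0}) (J₀ : X₁.IdealSheafData) (π : X₂ ⟶ X₁) (g : X₃ ⟶ X₂),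
    IsIntegral X₁ → IsNoetherian X₁ → J₀ ≠ ⊥ → IsBlowup π J₀ → IsIntegral X₃ → IsFinite g →
    Function.Surjective g.base →
    (∀ x₃ : X₃, π.base (g.base x₃) ∉ (J₀.support : Set X₁) → IsIso (g.stalkMap x₃)) →
    ∃ J : X₁.IdealSheafData, J ≠ ⊥ ∧ J.support = J₀.support ∧ IsBlowup (g ≫ π) J

/-! ## Plumbing (proved) -/

/-- A minimal point of the specialisation order is a closed point (copy of `ProjModel.isClosed_singleton_of_isMin`, kept local
to stay out of that file's variables). [folklore] -/
theorem isClosed_singleton_of_isMin' {X : Scheme.{0}} {a : X} (h : IsMin a) : IsClosed ({a} : Set X) := by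
  refine isClosed_of_closure_subset fun y hy => ?_
  have hay : a ⤳ y := specializes_iff_mem_closure.mpr hy
  have hle : y ≤ a := hay
  have hya : y ⤳ a := h hle
  exact (hya.antisymm hay).eq

/-- **In a scheme of dimension ≤ 2 a non-closed point has a local ring of dimension ≤ 1**: `height x ≥ 1` (a non-closed point
is not minimal) and `height x + coheight x ≤ dim X` (`Literature…height_add_coheight_le_topologicalKrullDim`), while
`dim 𝒪_{X,x} = coheight x` (Mathlib `ringKrullDim_stalk_eq_coheight`). [folklore] -/
theorem ringKrullDim_stalk_le_one_of_not_isClosed {X : Scheme.{0}} (hX : topologicalKrullDim X ≤ 2) {x : X}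
    (hx : ¬ IsClosed ({x} : Set X)) : ringKrullDim (X.presheaf.stalk x) ≤ 1 := by
  have h0 : Order.height x ≠ 0 := fun h => hx (isClosed_singleton_of_isMin' (Order.height_eq_zero.mp h))
  have h1 : (1 : ℕ∞) ≤ Order.height x := Order.one_le_iff_ne_zero.mpr h0
  have h2 := Literature.AlgebraicGeometry.Dimension.height_add_coheight_le_topologicalKrullDim x
  have h3 : ((Order.height x + Order.coheight x : ℕ∞) : WithBot ℕ∞) ≤ ((2 : ℕ∞) : WithBot ℕ∞) :=
    h2.trans (by exact_mod_cast hX)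
  have h4 : Order.height x + Order.coheight x ≤ 2 := by exact_mod_cast h3
  have h5 : (1 : ℕ∞) + Order.coheight x ≤ 1 + 1 :=
    calc (1 : ℕ∞) + Order.coheight x ≤ Order.height x + Order.coheight x := add_le_add h1 le_rfl
      _ ≤ 2 := h4
      _ = 1 + 1 := one_add_one_eq_two.symm
  have h6 : Order.coheight x ≤ 1 := (ENat.add_le_add_iff_left (by simp)).mp h5
  rw [ringKrullDim_stalk_eq_coheight]
  exact_mod_cast h6

/-- **A blowing up of a point-fixable stalk centre is FULL over that point**: if `π : X₂ → X₁` blows up `J₀` with `J₀,s = (c)`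
and every chart `𝒪_s[(c)/c_j]` localised at a prime over `𝔪_s` is FULL, then so is every stalk of `X₂` over `s` (Stacks 0804
dictionary `IsBlowup.exists_blowupAlgebra_stalk_ringEquiv`, transport along the ring isomorphism). [folklore assembly] -/
theorem full_stalk_of_isBlowup_of_chartClause (p : ℕ) {X₁ X₂ : Scheme.{0}} {J₀ : X₁.IdealSheafData} {π : X₂ ⟶ X₁}
    (hπ : IsBlowup π J₀) (x₂ : X₂) (s : X₁) (hs : π.base x₂ = s) {n : ℕ} (c : Fin n → X₁.presheaf.stalk s)
    (hc : stalkIdeal J₀ s = Ideal.span (Set.range c))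
    (hgood : ∀ (j : Fin n) (𝔔 : PrimeSpectrum (blowupAlgebra (Ideal.span (Set.range c)) (c j))),
      𝔔.asIdeal.comap (algebraMap (X₁.presheaf.stalk s) (blowupAlgebra (Ideal.span (Set.range c)) (c j))) =
        maximalIdeal (X₁.presheaf.stalk s) →
      IsDomain (Localization.AtPrime 𝔔.asIdeal) ∧ Clause p (Localization.AtPrime 𝔔.asIdeal)) :
    IsDomain (X₂.presheaf.stalk x₂) ∧ Clause p (X₂.presheaf.stalk x₂) := by
  subst hs
  obtain ⟨j, 𝔔, χ, e, -, -, -, h𝔔⟩ := hπ.exists_blowupAlgebra_stalk_ringEquiv x₂ c hc.symm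
  obtain ⟨hdom, hcl⟩ := hgood j 𝔔 h𝔔
  haveI := hdom
  exact ⟨MulEquiv.isDomain _ e.toMulEquiv, DegreeZeroDescent.inlineClause_of_ringEquiv p e.symm hcl⟩

/-! ## The kernel: the dim ≤ 2 rung from the inputs (sorry-free) -/

/-- [OURS] **THE d ≤ 2 RUNG OF FC′ modulo the typed inputs** — `NonFullLocusClosed → S2Modification →
FiniteModificationOfBlowupIsBlowup → FCForallExistsDimLe2` (S-N1 is the theorem `NonFullLocusClosed.regularOfNormalDimLeOne`), by the
construction described in the file header; no resolution of surfaces. The two facts with genuinely new content are S-S2 (a construction) and S-V (the Veronese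
blow-up lemma); S-DM is print-backed, S-N1 is Mathlib glue. REMARK: the proof does not use `hη` (nor separatedness): in
dimension ≤ 2 the FC′ witness exists at EVERY point carrying a point-fix datum. [candidate kernel, OURS · AI-written] -/
theorem fcForallExistsDimLe2_of (hDM : NonFullLocusClosed) (hS2 : S2Modification)
    (hV : FiniteModificationOfBlowupIsBlowup) : FCForallExistsDimLe2 := by
  classical
  intro p hp k _ _ X₁ f₁ hsep hft hqc hint hdim hCM η hη n c hc0 hrad hgood
  haveI := hft; haveI := hqc; haveI := hint
  haveI : Fact p.Prime := ⟨hp⟩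
  haveI : IsNoetherian X₁ := Scheme.isNoetherian_of_finiteType_over_field f₁
  -- (i) spread the point-fix datum `c` to an ideal sheaf `J₀ ≠ 0` with `J₀,η = (c)`
  have hcm : Ideal.span (Set.range c) ≤ maximalIdeal (X₁.presheaf.stalk η) :=
    le_trans Ideal.le_radical hrad.le
  obtain ⟨J₀, hJ₀, hηJ₀, hJ₀η⟩ := CentreSpread.centreSpread X₁ η n c hc0 hcm
  -- (ii) the first blowing up
  obtain ⟨X₂, π, hπ⟩ := exists_isBlowup X₁ J₀
  haveI : IsIntegral X₂ := hπ.isIntegral hJ₀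
  haveI : IsProper π := hπ.isProper
  have hdim₂ : topologicalKrullDim X₂ ≤ 2 := by
    have h := hπ.topologicalKrullDim_le (n := 2) (by exact_mod_cast hdim)
    exact_mod_cast h
  -- (iii) `X₂` is FULL over `η`
  have hfullη : ∀ x₂ : X₂, π.base x₂ = η → IsDomain (X₂.presheaf.stalk x₂) ∧ Clause p (X₂.presheaf.stalk x₂) :=
    fun x₂ hx₂ => full_stalk_of_isBlowup_of_chartClause p hπ x₂ η hx₂ c hJ₀η hgood
  -- (iv) the bad set `F := π⁻¹(supp J₀) ∩ nonFULL(X₂)`, closed by S-DM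
  set F : Set X₂ := (π.base ⁻¹' (J₀.support : Set X₁)) ∩ {x₂ : X₂ | ¬ Clause p (X₂.presheaf.stalk x₂)} with hFdef
  have hFcl : IsClosed F :=
    (J₀.support.isClosed.preimage π.continuous).inter (hDM p hp k X₂ (π ≫ f₁) inferInstance inferInstance inferInstance)
  -- (v) `X₂` is Cohen–Macaulay off `F`
  have hCMoff : ∀ y : X₂, y ∉ F → CMClause (X₂.presheaf.stalk y) := by
    intro y hy
    by_cases hys : π.base y ∈ (J₀.support : Set X₁)
    · have hcl : Clause p (X₂.presheaf.stalk y) := by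
        by_contra hnc
        exact hy ⟨hys, hnc⟩
      exact fun d hd s hs => (hcl d hd s hs).1
    · obtain ⟨e⟩ := IsBlowupStalkOffSupport.stub_isBlowupStalkOffSupport X₁ X₂ J₀ π hπ y hys
      exact FiLocusOpenOfAffine.cmClause_of_ringEquiv e.symm (hCM (π.base y))
  -- (vi) the S₂-modification along `F`
  obtain ⟨X₃, g, hint₃, hnoeth₃, hfin, hsurj, hiso, hgoodF⟩ :=
    hS2 k X₂ (π ≫ f₁) inferInstance inferInstance inferInstance hdim₂ F hFcl hCMoff
  haveI := hint₃; haveI := hnoeth₃; haveI := hfin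
  -- (vii) the Veronese blow-up lemma: `X₃ → X₁` is ONE blowing up along `J`, `supp J = supp J₀`
  obtain ⟨J, hJ, hsuppJ, hf⟩ := hV X₁ X₂ X₃ J₀ π g hint inferInstance hJ₀ hπ hint₃ hfin hsurj
    (fun x₃ hx₃ => hiso x₃ (fun hF => hx₃ hF.1))
  -- (viii) `c' :=` generators of `J_η`
  obtain ⟨n', c', hc'⟩ : ∃ (n' : ℕ) (c' : Fin n' → X₁.presheaf.stalk η),
      Ideal.span (Set.range c') = stalkIdeal J η :=
    Submodule.fg_iff_exists_fin_generating_family.mp (IsNoetherian.noetherian _)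
  have hηJ : η ∈ (J.support : Set X₁) := by rw [hsuppJ]; exact hηJ₀
  -- FULL transfers from `X₂` (off `F`, over `supp J₀`) to any scheme with the stalks of `X₃`
  have offF : ∀ (x₃ : X₃) (L : Type) [CommRing L], π.base (g.base x₃) ∈ (J₀.support : Set X₁) → g.base x₃ ∉ F →
      ∀ e : L ≃+* X₃.presheaf.stalk x₃, IsDomain L ∧ Clause p L := by
    intro x₃ L _ hsupp₀ hnotF e
    have hcl : Clause p (X₂.presheaf.stalk (g.base x₃)) := by
      by_contra hnc
      exact hnotF ⟨hsupp₀, hnc⟩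
    haveI := hiso x₃ hnotF
    let e₂ : X₂.presheaf.stalk (g.base x₃) ≃+* X₃.presheaf.stalk x₃ := (asIso (g.stalkMap x₃)).commRingCatIsoToRingEquiv
    exact ⟨MulEquiv.isDomain _ e.toMulEquiv, DegreeZeroDescent.inlineClause_of_ringEquiv p (e₂.trans e.symm) hcl⟩
  refine ⟨J, n', c', hJ, hηJ, ?_, ?_, ?_, hc'.symm, ?_⟩
  · rw [hc']; exact stalkIdeal_ne_bot_of_ne_bot hJ η
  · rw [hc']; exact (mem_support_iff_stalkIdeal_le J η).mp hηJ
  · -- the charts of `Bl_(c')𝒪_η` over `𝔪_η` are stalks of `X₃` over `η`; there `g` is a stalk isomorphism onto FULL stalks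
    intro j 𝔔 h𝔔
    obtain ⟨x₃, hx₃, ⟨e⟩⟩ := hf.exists_point_of_blowupAlgebra_prime η c' hc' j 𝔔 h𝔔
    have hgx : π.base (g.base x₃) = η := hx₃
    have hfull₂ := hfullη (g.base x₃) hgx
    have hnotF : g.base x₃ ∉ F := fun hF => hF.2 hfull₂.2
    have hsupp₀ : π.base (g.base x₃) ∈ (J₀.support : Set X₁) := by rw [hgx]; exact hηJ₀
    exact offF x₃ (Localization.AtPrime 𝔔.asIdeal) hsupp₀ hnotF e.symm
  · intro X₂' π' hπ'
    have hdim' : topologicalKrullDim X₂' ≤ 2 := by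
      have h := hπ'.topologicalKrullDim_le (n := 2) (by exact_mod_cast hdim)
      exact_mod_cast h
    -- every point of `X₂'` has a partner in `X₃` over the same point of `X₁` with an isomorphic local ring
    have partner : ∀ x' : X₂', ∃ x₃ : X₃, π.base (g.base x₃) = π'.base x' ∧
        Nonempty (X₂'.presheaf.stalk x' ≃+* X₃.presheaf.stalk x₃) := by
      intro x'
      obtain ⟨x₃, hx₃, he⟩ := IsBlowupStalkTransfer.stub_isBlowupStalkTransfer X₁ X₂' X₃ J π' (g ≫ π) hπ' hf x'
      exact ⟨x₃, hx₃, he⟩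
    have suppJ₀ : ∀ (x' : X₂') (x₃ : X₃), π.base (g.base x₃) = π'.base x' → π'.base x' ∈ (J.support : Set X₁) →
        π.base (g.base x₃) ∈ (J₀.support : Set X₁) := by
      intro x' x₃ hx hJ'
      rw [hx, ← hsuppJ]; exact hJ'
    refine ⟨fun x' hJ' _hne hncl => ?_, fun x' hJ' _hcl => ?_⟩
    · -- (nc): a non-closed point has local dimension ≤ 1
      obtain ⟨x₃, hx, ⟨e⟩⟩ := partner x'
      by_cases hF : g.base x₃ ∈ F
      · have hd1 : ringKrullDim (X₂'.presheaf.stalk x') ≤ 1 := ringKrullDim_stalk_le_one_of_not_isClosed hdim' hncl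
        have hd3 : ringKrullDim (X₃.presheaf.stalk x₃) ≤ 1 := by rwa [ringKrullDim_eq_of_ringEquiv e] at hd1
        have hic : IsIntegrallyClosed (X₃.presheaf.stalk x₃) := (hgoodF x₃ hF).2 hd3
        -- (landed F2 binder shape: `[IsDomain R]` instance-implicit — the integral scheme `X₃` supplies it)
        haveI : IsRegularLocalRing (X₃.presheaf.stalk x₃) := NonFullLocusClosed.regularOfNormalDimLeOne (X₃.presheaf.stalk x₃) hic hd3
        have hreg' : IsRegularLocalRing (X₂'.presheaf.stalk x') := IsRegularLocalRing.of_ringEquiv e.symm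
        exact RegularPointClause.fiClause_stalk_of_isRegularLocalRing p (π' ≫ f₁) x' hreg'
      · exact offF x₃ (X₂'.presheaf.stalk x') (suppJ₀ x' x₃ hx hJ') hF e
    · -- (cl): Cohen–Macaulay at every point over `supp J`
      obtain ⟨x₃, hx, ⟨e⟩⟩ := partner x'
      by_cases hF : g.base x₃ ∈ F
      · exact FiLocusOpenOfAffine.cmClause_of_ringEquiv e.symm (hgoodF x₃ hF).1
      · exact fun d hd s hs => ((offF x₃ (X₂'.presheaf.stalk x') (suppJ₀ x' x₃ hx hJ') hF e).2 d hd s hs).1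

/-- [OURS] **THE d ≤ 2 RUNG OF FC′ modulo Datta–Murayama (BY NAME), Cohen–Macaulay openness, S-S2 and S-V.**
[candidate kernel, OURS · AI-written] -/
theorem fcForallExistsDimLe2_of_named
    (hDM : Literature.AlgebraicGeometry.Resolution.DattaMurayama2024_fInjectiveLocusOpen.{0})
    (hCMo : CMLocusOpen) (hS2 : S2Modification) (hV : FiniteModificationOfBlowupIsBlowup) :
    FCForallExistsDimLe2 :=
  fcForallExistsDimLe2_of (nonFullLocusClosed_of_named hDM hCMo) hS2 hV

end Summit.ResolutionOfSingularities.ResolutionOfSingularities.Theorems.FInjectiveMacaulayfication.FCForallExistsDimLe2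

end
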